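import Summits.AtomisticToContinuum.Crystallization.Theorems.FrustratedLawDichotomyStrainedPatchHomConvexCurvature
import Literature.Analysis.ValidatedNumerics.IntervalGershgorin

/-!
# Kernel kit for the `λ`-leaf of lever (C): the DOMINANCE TEST and the HESSIAN-ENTRY ACCUMULATOR (fixed-point intervals, scale `2^48`)

decomp-a2c hand-1 g26 (crux `AperiodicFrustratedLawGap`, stmt-AtomisticToContinuum-27623; `(H) HomFloor (1/625)`, hcp half; critic rows 1026 (C) /
1030: «kernel λ-leaf = entrywise 3×3 enclosure + Gershgorin/PSD (hand-1 lineage)»).  `…HomConvexCurvature.curvatureSum_ge_of_enclosure` reduces the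
curvature-sum floor `λ‖Δ‖² ≤ Σ_b (α_b⟪c_b, Δ⟫² + β_b‖Δ‖²)` to REAL enclosures `lo ≤ M ≤ hi` of the six Hessian entries
`M i j = Σ_b (α_b (c_b)_i (c_b)_j + [i=j] β_b)` and the end-point dominance test.  This file is the regime-independent KERNEL side in the cell's
fixed-point interval currency `FI` (`Literature.Analysis.ValidatedNumerics.Numerics`, scale `SC = 2^48`; the same currency as hand-2's `…HomForceKit`):

* §1 `accFI` — interval sum of per-label intervals over a label LIST, ★ `mem_accFI` (membership of `Σ_{b ∈ L.toFinset}` for `L.Nodup`);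
* §2 `hessEntryFI` — the accumulator `Σ_b (A_b·(C_b i·C_b j) + [i=j] B_b)` from per-label enclosures `A_b ∋ α_b`, `B_b ∋ β_b`, `C_b a ∋ (c_b)_a`, ★ `mem_hessEntryFI`;
* §3 `domTest E lamS : Bool` — `lamS + Σ_{j≠i} absHi (E i j) ≤ (E i i).lo` for each row (integers only), ★ `htest_of_domTest` (the real end-point test of
  `…HomConvexCurvature` with `λ = lamS/SC`, `lo = E.lo/SC`, `hi = E.hi/SC`);
* §4 ★★★ `curvatureSum_ge_of_domTest` — per-label memberships + `domTest (hessEntryFI …) lamS = true` ⟹ `(lamS/SC)‖Δ‖² ≤ Σ_b (α_b⟪c_b, Δ⟫² + β_b‖Δ‖²)`.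
  What remains for the leaf proper is only the per-label enclosure of `α_b = (W₄₅″ − W₄₅′/ρ)/ρ²`, `β_b = W₄₅′/ρ` (three radial regimes) and of `c_b`
  (hand-2's `vecB` over the entry/shuffle box).

Four kernel definitions (Bool/FI-valued, docstring'd) + soundness; 0 sorry; standard axioms; no instances / notation / `#eval`.
`--supports stmt-AtomisticToContinuum-27623`.
-/

noncomputable section

namespace Summit.AtomisticToContinuum.Crystallization.Theorems.FrustratedLawDichotomyStrainedPatchHomCurvKit

open scoped BigOperators RealInnerProductSpace
open Literature.Analysis.ValidatedNumerics.Numerics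
open Literature.Analysis.ValidatedNumerics.IntervalGershgorin (lsum mem_foldl_add)
open Summit.AtomisticToContinuum.Crystallization.Theorems.FrustratedLawDichotomyStrainedPatchHomConvexCurvature (curvatureSum_ge_of_enclosure)

/-! ## §1. Interval sum over a label list -/

/-- Interval sum of the per-label intervals `t b`, `b ∈ L` (left fold). -/
def accFI {ι : Type*} (L : List ι) (t : ι → FI) : FI := lsum (L.map t)

/-- ★ Membership of the label sum in the interval sum (`L` without duplicates). [folklore] -/
theorem mem_accFI {ι : Type*} [DecidableEq ι] (L : List ι) (hL : L.Nodup) {g : ι → ℝ} {t : ι → FI} (h : ∀ b ∈ L, FI.mem (g b) (t b)) :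
    FI.mem (∑ b ∈ L.toFinset, g b) (accFI L t) := by
  have hz : FI.mem (0 : ℝ) (FI.ofInt 0) := by simpa using FI.mem_ofInt 0
  have h2 : List.Forall₂ (fun x I => FI.mem x I) (L.map g) (L.map t) := by
    rw [List.forall₂_map_left_iff, List.forall₂_map_right_iff, List.forall₂_same]
    exact h
  have hmain := mem_foldl_add hz (L.map t) (L.map g) h2
  rw [zero_add] at hmain
  rw [List.sum_toFinset _ hL]
  exact hmain

/-! ## §2. The Hessian-entry accumulator -/

/-- The interval of the Hessian entry `M i j = Σ_b (α_b (c_b)_i (c_b)_j + [i=j] β_b)` from per-label enclosures `A b ∋ α_b`, `B b ∋ β_b`, `C b a ∋ (c_b)_a`. -/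
def hessEntryFI {ι : Type*} (L : List ι) (A B : ι → FI) (C : ι → Fin 3 → FI) (i j : Fin 3) : FI :=
  accFI L fun b => ((A b).mul ((C b i).mul (C b j))).add (if i = j then B b else FI.ofInt 0)

/-- ★ Soundness of the accumulator. [folklore] -/
theorem mem_hessEntryFI {ι : Type*} [DecidableEq ι] (L : List ι) (hL : L.Nodup) {α β : ι → ℝ} {c : ι → EuclideanSpace ℝ (Fin 3)}
    {A B : ι → FI} {C : ι → Fin 3 → FI} (hA : ∀ b ∈ L, FI.mem (α b) (A b)) (hB : ∀ b ∈ L, FI.mem (β b) (B b))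
    (hC : ∀ b ∈ L, ∀ a, FI.mem (c b a) (C b a)) (i j : Fin 3) :
    FI.mem (∑ b ∈ L.toFinset, (α b * (c b i * c b j) + (if i = j then β b else 0))) (hessEntryFI L A B C i j) := by
  refine mem_accFI L hL fun b hb => FI.mem_add (FI.mem_mul (hA b hb) (FI.mem_mul (hC b hb i) (hC b hb j))) ?_
  by_cases hij : i = j
  · rw [if_pos hij, if_pos hij]; exact hB b hb
  · rw [if_neg hij, if_neg hij]; simpa using FI.mem_ofInt 0

/-! ## §3. The dominance test -/

/-- ★ **Dominance test** (integers only): `lamS + Σ_{j ≠ i} absHi (E i j) ≤ (E i i).lo` for every row `i`. -/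
def domTest (E : Fin 3 → Fin 3 → FI) (lamS : ℤ) : Bool :=
  decide (∀ i : Fin 3, lamS + ∑ j : Fin 3, (if j = i then 0 else (E i j).absHi) ≤ (E i i).lo)

/-- ★ Soundness of the dominance test: the real end-point test of `…HomConvexCurvature` with `λ = lamS/SC`, `lo = E.lo/SC`, `hi = E.hi/SC`. [folklore] -/
theorem htest_of_domTest {E : Fin 3 → Fin 3 → FI} {lamS : ℤ} (h : domTest E lamS = true) :
    ∀ i : Fin 3, (lamS : ℝ) / SC + (∑ j : Fin 3, if j = i then 0 else max |((E i j).lo : ℝ) / SC| |((E i j).hi : ℝ) / SC|) ≤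
      ((E i i).lo : ℝ) / SC := by
  have hS : (0 : ℝ) < SC := by norm_num [SC]
  have hdec := of_decide_eq_true h
  intro i
  have hi := hdec i
  have hcast : ((lamS + ∑ j : Fin 3, (if j = i then 0 else (E i j).absHi) : ℤ) : ℝ) ≤ ((E i i).lo : ℝ) := by exact_mod_cast hi
  push_cast at hcast
  have hterm : ∀ j : Fin 3, (if j = i then (0 : ℝ) else max |((E i j).lo : ℝ) / SC| |((E i j).hi : ℝ) / SC|) =
      (if j = i then (0 : ℝ) else ((E i j).absHi : ℝ)) / SC := by
    intro j
    split_ifs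
    · simp
    · rw [FI.absHi, Int.cast_max, Int.cast_abs, Int.cast_abs, abs_div, abs_div, abs_of_pos hS, max_div_div_right hS.le]
  have hsum : (∑ j : Fin 3, if j = i then (0 : ℝ) else max |((E i j).lo : ℝ) / SC| |((E i j).hi : ℝ) / SC|) =
      (∑ j : Fin 3, (if j = i then (0 : ℝ) else ((E i j).absHi : ℝ))) / SC := by
    rw [Finset.sum_div]
    exact Finset.sum_congr rfl fun j _ => hterm j
  rw [hsum, ← add_div, div_le_div_iff_of_pos_right hS]
  have hite : (∑ j : Fin 3, (if j = i then (0 : ℝ) else ((E i j).absHi : ℝ))) = ∑ j : Fin 3, ((if j = i then (0 : ℤ) else (E i j).absHi : ℤ) : ℝ) :=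
    Finset.sum_congr rfl fun j _ => by split_ifs <;> simp
  have hcast' : (lamS : ℝ) + ∑ j : Fin 3, ((if j = i then (0 : ℤ) else (E i j).absHi : ℤ) : ℝ) ≤ ((E i i).lo : ℝ) := by
    have : (∑ j : Fin 3, ((if j = i then (0 : ℤ) else (E i j).absHi : ℤ) : ℝ)) = ∑ x : Fin 3, (if x = i then (0 : ℝ) else ((E i x).absHi : ℝ)) :=
      Finset.sum_congr rfl fun j _ => by split_ifs <;> simp
    rw [this]; exact hcast
  rw [hite]
  exact hcast'

/-! ## §4. ★★★ The curvature-sum floor from the kernel test -/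

/-- ★★★ **CURVATURE-SUM FLOOR FROM THE KERNEL DOMINANCE TEST.**  Per-label memberships `α_b ∈ A b`, `β_b ∈ B b`, `(c_b)_a ∈ C b a` over a
duplicate-free label list `L`, and `domTest (hessEntryFI L A B C) lamS = true`, give `(lamS/SC)·‖Δ‖² ≤ Σ_{b ∈ L} (α_b⟪c_b, Δ⟫² + β_b‖Δ‖²)` for every `Δ`.
With `α_b, β_b, c_b` as in `…HomConvexCurvature.segGd_sum_ge_of_enclosure` this is the `hcurv` input of `…HomConvexSegmentW45.hcpShifted_floor_W45`.
[folklore chaining] -/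
theorem curvatureSum_ge_of_domTest {ι : Type*} [DecidableEq ι] (L : List ι) (hL : L.Nodup) {α β : ι → ℝ}
    {c : ι → EuclideanSpace ℝ (Fin 3)} {A B : ι → FI} {C : ι → Fin 3 → FI} (hA : ∀ b ∈ L, FI.mem (α b) (A b))
    (hB : ∀ b ∈ L, FI.mem (β b) (B b)) (hC : ∀ b ∈ L, ∀ a, FI.mem (c b a) (C b a)) {lamS : ℤ}
    (h : domTest (hessEntryFI L A B C) lamS = true) (Δ : EuclideanSpace ℝ (Fin 3)) :
    (lamS : ℝ) / SC * ‖Δ‖ ^ 2 ≤ ∑ b ∈ L.toFinset, (α b * ⟪c b, Δ⟫ ^ 2 + β b * ‖Δ‖ ^ 2) := by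
  have hS : (0 : ℝ) < SC := by norm_num [SC]
  set E := hessEntryFI L A B C with hE
  have hmem := fun i j => mem_hessEntryFI L hL hA hB hC i j
  refine curvatureSum_ge_of_enclosure L.toFinset α β c (fun i j => ((E i j).lo : ℝ) / SC) (fun i j => ((E i j).hi : ℝ) / SC)
    (fun i j => ?_) (fun i j => ?_) (htest_of_domTest h) Δ
  · exact FI.lo_div_le (hmem i j)
  · exact FI.le_hi_div (hmem i j)

end Summit.AtomisticToContinuum.Crystallization.Theorems.FrustratedLawDichotomyStrainedPatchHomCurvKit

end
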